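import Mathlib
import HarnessLib
import Literature.Analysis.FluidPDE.Tao2016AveragedNS.LocalCascadeSolutions
import Literature.Analysis.FluidPDE.Tao2016AveragedNS.RenormalisedCascadeWaves
import Literature.Analysis.FluidPDE.Tao2016AveragedNS.SelfSimilarCascadeBlowup
import Literature.Analysis.FluidPDE.Tao2016AveragedNS.BoundedEternalSolutions
import Summits.NavierStokesRegularity.NavierStokesRegularity.Theses.TaoLadderRungTwoBreak
import Summits.NavierStokesRegularity.NavierStokesRegularity.Theorems.TaoLadderRungTwoBreakNoSurvivingEternalViscBddOneSmallActionRung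

/-!
# The SMALL-PROFILE-ACTION slice of K1(1) `TaoLadderRungTwoBreak.NoSurvivingDSSOne` (stmt-NavierStokesRegularity-20205)
# — period-free

MODEL lattice ODEs only (Tao 2016 §4, §6.4; cell vocabulary `IsDSSWave`, `dssEmbed`, `Surviving`); nothing here is a
statement about the Navier–Stokes equations; no summit, crux or rung LEAF is proved
(`--supports stmt-NavierStokesRegularity-20205`).

The small-action slice of K1ᵛ(1) (`…NoSurvivingEternalViscBddOneSmallActionRung.noSurvivingEternalViscBdd_rung_smallAction`:
a uniformly bounded admissible eternal solution all of whose per-shell actions are `≤ 1/400` is not forward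
(S₁)-surviving, any `ε₀ ∈ (0,1]`, any table of any class) transported to admissible DSS blow-up waves through the
shell-wise embedding `dssEmbed` (tree: `IsDSSWave.isEternal_dssEmbed`, `uniformBound_dssEmbed`,
`eternalSurvivingFwd_dssEmbed`): the per-shell action of the embedding is the action `∫‖Φ_r‖` of ONE profile
(`integral_norm_dssEmbed`), so

* `noSurvivingDSS_rung_smallProfileAction` — **K1(1) HOLDS, with threshold `εs = 1`, for admissible DSS waves all of
  whose PROFILES have action `∫‖Φ_r‖ ≤ 1/400`** — every period `q`, shape permutation, delay, every class
  `InTableClass R`; equivalently a non-trivial (S₁)-surviving admissible DSS wave has SOME profile of action `> 1/400`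
  (`exists_profile_action_gt_of_surviving`).  This slice is PERIOD-FREE, unlike the bounded-`dssAction` slice of
  `…NoSurvivingDSSOneActionFloor` (whose action exponent sums all `q` profiles and grows like `log(1/ε₀)`); the two
  are complementary.  Case of the crux by name: `smallProfileAction_of_noSurvivingDSSOne`.
-/

noncomputable section

-- the summit and its single sub-problem share the name (CONVENTIONS §1)
set_option linter.dupNamespace false

namespace Summit.NavierStokesRegularity.NavierStokesRegularity.Theorems.NoSurvivingDSSOne.SmallProfileAction

open Set Filter Topology MeasureTheory
open Literature.Analysis.FluidPDE Literature.Analysis.FluidPDE.TaoCascade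
open Summit.NavierStokesRegularity.NavierStokesRegularity.Theses.TaoLadderRungTwoBreak
open Summit.NavierStokesRegularity.NavierStokesRegularity.Theorems.NoSurvivingEternalViscBddOne.SmallAction

variable {ρ : Type*} [Fintype ρ] {m : ℕ}

omit [Fintype ρ] in
/-- The per-shell action of the eternal solution carried by a DSS wave is the action of one profile:
`∫‖(dssEmbed π T Φ r₀) n‖ = ∫‖Φ_{πⁿ r₀}‖`. [cite: Tao2016AveragedNS, §4 Lemma 4.1 (4.8), §6.4; cell vocabulary (`dssEmbed`)] -/
theorem integral_norm_dssEmbed (π : Equiv.Perm ρ) (T : ℝ) (Φ : ρ → ℝ → Em m) (r₀ : ρ) (n : ℤ) :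
    ∫ σ, ‖dssEmbed π T Φ r₀ n σ‖ = ∫ x, ‖Φ ((π ^ n) r₀) x‖ := by
  simp only [dssEmbed]
  exact MeasureTheory.integral_sub_right_eq_self (fun x => ‖Φ ((π ^ n) r₀) x‖) ((n : ℝ) * T)

/-- **K1(1) ON THE SMALL-PROFILE-ACTION CLASS (period-free).**  For every spread `R`: for all `ε₀ ∈ (0, 1]`, every
table of `InTableClass R`, every admissible DSS wave (any period `q`, shape permutation `π`, delay `T`) that is
(S₁)-surviving and all of whose profiles have action `∫‖Φ_r‖ ≤ 1/400` is trivial.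
[cite: Tao2016AveragedNS, §4 Thm. 4.2 (statement shape), Lemma 4.1 (4.8)–(4.10), §6.4; tree embedding lemmas + `…SmallActionRung`] -/
theorem noSurvivingDSS_rung_smallProfileAction (R : ℝ) :
    ∀ ε₀ : ℝ, 0 < ε₀ → ε₀ ≤ 1 →
      ∀ α : Fin 4 → Fin 4 → Fin 4 → ℤ × ℤ × ℤ → ℝ, InTableClass R α →
        ∀ (q : ℕ) (π : Equiv.Perm (Fin q)) (T : ℝ) (Φ : Fin q → ℝ → Em 4),
          IsDSSWave ε₀ α π T Φ → Surviving 1 ε₀ T → (∀ r, ∫ x, ‖Φ r x‖ ≤ 1 / 400) → ∀ r x, Φ r x = 0 := by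
  intro ε₀ hε₀ hle α hα q π T Φ hW hS hact r x
  by_contra hne
  have hsurv : EternalSurvivingFwd 1 ε₀ (dssEmbed π T Φ r) := eternalSurvivingFwd_dssEmbed hε₀ hW.delay_pos hS hne
  have hM : ∀ n : ℤ, ∫ σ, ‖dssEmbed π T Φ r n σ‖ ≤ 1 / 400 := fun n => by
    rw [integral_norm_dssEmbed]; exact hact _
  exact noSurvivingEternalViscBdd_rung_smallAction R ε₀ hε₀ hle α hα 0 (dssEmbed π T Φ r)
    (hW.isEternal_dssEmbed r).isEternalVisc (uniformBound_dssEmbed hW r) hM hsurv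

/-- Equivalently: **a non-trivial (S₁)-surviving admissible DSS wave (`ε₀ ≤ 1`, any class) has SOME profile of
action `> 1/400`.** [cite: Tao2016AveragedNS, §4 Thm. 4.2 (statement shape), §6.4; this file] -/
theorem exists_profile_action_gt_of_surviving {R ε₀ : ℝ} (hε₀ : 0 < ε₀) (hle : ε₀ ≤ 1)
    {α : Fin 4 → Fin 4 → Fin 4 → ℤ × ℤ × ℤ → ℝ} (hα : InTableClass R α) {q : ℕ} {π : Equiv.Perm (Fin q)}
    {T : ℝ} {Φ : Fin q → ℝ → Em 4} (hW : IsDSSWave ε₀ α π T Φ) (hS : Surviving 1 ε₀ T) (hne : ∃ r x, Φ r x ≠ 0) :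
    ∃ r, 1 / 400 < ∫ x, ‖Φ r x‖ := by
  by_contra hno
  push Not at hno
  obtain ⟨r, x, hrx⟩ := hne
  exact hrx (noSurvivingDSS_rung_smallProfileAction R ε₀ hε₀ hle α hα q π T Φ hW hS hno r x)

/-- The slice IS a case of the crux `NoSurvivingDSSOne` (with the crux's threshold, any budget).
[cite: Tao2016AveragedNS, §4 Thm. 4.2 (statement shape); cell vocabulary] -/
theorem smallProfileAction_of_noSurvivingDSSOne (hK : NoSurvivingDSSOne) (R M₀ : ℝ) (hR : 1 ≤ R) :
    ∃ εs : ℝ, 0 < εs ∧ ∀ ε₀ : ℝ, 0 < ε₀ → ε₀ ≤ εs →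
      ∀ α : Fin 4 → Fin 4 → Fin 4 → ℤ × ℤ × ℤ → ℝ, InTableClass R α →
        ∀ (q : ℕ) (π : Equiv.Perm (Fin q)) (T : ℝ) (Φ : Fin q → ℝ → Em 4),
          IsDSSWave ε₀ α π T Φ → Surviving 1 ε₀ T → (∀ r, ∫ x, ‖Φ r x‖ ≤ M₀) → ∀ r x, Φ r x = 0 := by
  obtain ⟨εs, hεs, H⟩ := hK R hR
  exact ⟨εs, hεs, fun ε₀ hε₀ hle α hα q π T Φ hW hS _ => H ε₀ hε₀ hle α hα q π T Φ hW hS⟩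

end Summit.NavierStokesRegularity.NavierStokesRegularity.Theorems.NoSurvivingDSSOne.SmallProfileAction

end
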